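import Literature.NumberTheory.Rogawski1990.TransferFactsMatrices                   -- ★ `ArchCanonicalSingularMatrix` (hACS of the S1′ letter)
import Literature.NumberTheory.Rogawski1990.ArchSingularMembersOfRegularData         -- ★ (W4e) `exists_rational_diagonal_frame`
import Literature.NumberTheory.Automorphic.UnitaryGroupOfLocalCovolumeStableKit      -- ★ `ne_zero_of_quotientMeasure_ne_zero`
import Literature.NumberTheory.Automorphic.UnitaryGroupArchUnimodular                -- ★ `modularCharacterFun_arch_eq_one`
import Literature.NumberTheory.Automorphic.ArchDiagonalTorus                         -- ★ `archDiagTorus`, `isRegularElt_archDiagTorus_exp_iff`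
import Literature.NumberTheory.Automorphic.ArchCongruenceOrbitalTransport            -- ★ `formCongr_map_mixedEmbedding_archFormOf_eq`
import Literature.MeasureTheory.Group.RightInvariantIsHaar                           -- ★ `isHaarMeasure_of_isMulRightInvariant_of_ne_zero`
import HarnessLib

/-!
# The archimedean Haar data of the S1′ frame ARE Haar measures: `νGi`, `νqi` under `ArchCanonicalSingularMatrix` (Rogawski 1990 §14.2 (14.2.1); §1.7 p. 6)

Topic `NumberTheory/Rogawski1990`; namespace `Literature.NumberTheory.Rogawski1990` (§2–§3) with two dot-notation extensions of
★ `Literature.NumberTheory.Automorphic.OrbitalMeasureFamily.IsQuotientOf` declared by absolute name (§1).  THEOREMS ONLY (no `def`, no instance, no notation, no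
axiom, no named fact, no `sorry`).  Cell `pub/hodgecm-mathlib`, ENGINE T1 (crux H413 = `stmt-HodgeConjecture-24833`); the `stub_S1` (S1′ = books #88) road, brick (b1) of
CENSUS (W7) 420dda0c (F0P3a-p07 (g10)).  Count-neutral; HONEST LABEL: HC_CM is proved only modulo the printed citations until rung 0 closes.

WHY.  The S1′ letter ★ `TamagawaSingularMembersExist` binds its archimedean Haar data `νGi` (on `G′_∞ = U(H′)(L⁺ ⊗ ℝ)`) and `νqi` (on `G_∞ = U(Φ₃)(L⁺ ⊗ ℝ)`) only as
«finite on compacta, right invariant» (MAIN-b's frame, (F2): they may a priori be `0`), while the (ST-∞) witness road (★ (W4e) `exists_archSingularMembers_of_regularData`,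
★ (W4f)) needs them HAAR.  Under the letter's own hypothesis `hACS : ArchCanonicalSingularMatrix …` they are: (W′)∕(W) say the regular archimedean families `m′`, `m` are
Weil quotients of `νGi`, `νqi`, (i)∕(ii) say those families are ADMISSIBLE (non-zero members) on the regular classes, and regular classes EXIST (§2) — so `νGi ≠ 0`
(★ `ne_zero_of_quotientMeasure_ne_zero`: a Weil quotient of the zero measure is zero), and a non-zero right-invariant Radon measure on the unimodular `U(H)(L⁺ ⊗ ℝ)`
(★ `modularCharacterFun_arch_eq_one`) is a Haar measure (★ `isHaarMeasure_of_isMulRightInvariant_of_ne_zero`).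

* §1 `OrbitalMeasureFamily.IsQuotientOf.ne_zero_of_isAdmissibleOn`, `….isHaarMeasure_of_isAdmissibleOn` (generic group).
* §2 `exists_isRegularElt_arch` — `U(H)(L⁺ ⊗ ℝ)` has a regular semisimple element (`H ∈ M₃(L)` hermitian non-degenerate): the torus point `t(e^{0i}, e^{1i}, e^{2i})` of a
  rational diagonal frame (★ Landherr `exists_rational_diagonal_frame`), transported along the form congruence.
* §3 **`isHaarMeasure_of_archCanonicalSingularMatrix`**, **`isHaarMeasure_quasiSplit_of_archCanonicalSingularMatrix`** — `νGi`, `νqi` are Haar under `hACS`.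

## References
* [Rogawski1990] J. D. Rogawski, *Automorphic Representations of Unitary Groups in Three Variables*, Ann. of Math. Stud. 123 (1990), §1.7 p. 6; §3.1 p. 19; §14.2 (14.2.1) p. 232.
* [DeitmarEchterhoff2014] A. Deitmar, S. Echterhoff, *Principles of Harmonic Analysis*, 2nd ed. (2014), Thm. 1.5.3.
* [Folland1999] G. B. Folland, *Real Analysis*, 2nd ed. (1999), Thm. 11.9.
-/

set_option autoImplicit false

noncomputable section

open MeasureTheory Measure NumberField NumberField.InfinitePlace NumberField.mixedEmbedding
open Literature.MeasureTheory.Group Literature.NumberTheory.Automorphic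
open Literature.NumberTheory.Automorphic.UnitaryGroup hiding hermForm
open Literature.AlgebraicGeometry.ShimuraVarieties (unitaryGroup hermForm)
open scoped Matrix MatrixGroups NNReal ENNReal

/-! ## §1 A Weil-form family admissible at one class has a non-zero (hence Haar) ambient measure -/

section Generic

variable {G : Type*} [Group G] [TopologicalSpace G] [IsTopologicalGroup G] [LocallyCompactSpace G] [SecondCountableTopology G]
  [T2Space G] [MeasurableSpace G] [BorelSpace G]
  [∀ γ : G, MeasurableSpace (G ⧸ Subgroup.centralizer ({γ} : Set G))]
  [∀ γ : G, BorelSpace (G ⧸ Subgroup.centralizer ({γ} : Set G))]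

/-- **A Weil-form family that is admissible at ONE `P`-class has a non-zero ambient measure**: `m c = dν ∕ dt_{γ_c}` (★ `IsQuotientOf`) and `m c ≠ 0`
(★ `IsAdmissibleOn`) force `ν ≠ 0` (★ `ne_zero_of_quotientMeasure_ne_zero`).  Dot-notation extension of ★ `OrbitalMeasureFamily.IsQuotientOf` (directory
`NumberTheory/Automorphic`), declared by absolute name. [cite: DeitmarEchterhoff2014, Thm. 1.5.3] [cite: Rogawski1990, §1.7 p. 6] -/
theorem _root_.Literature.NumberTheory.Automorphic.OrbitalMeasureFamily.IsQuotientOf.ne_zero_of_isAdmissibleOn {P : G → Prop} {ν : Measure G}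
    [IsFiniteMeasureOnCompacts ν] [ν.IsMulRightInvariant] {t : ∀ γ : G, Measure (Subgroup.centralizer ({γ} : Set G))} {m : OrbitalMeasureFamily G}
    (hW : m.IsQuotientOf P ν t) (hadm : m.IsAdmissibleOn P) (c : ConjClasses G) (hc : P (Quotient.out c)) : ν ≠ 0 := by
  obtain ⟨ht, hti, hm⟩ := hW c hc
  exact ne_zero_of_quotientMeasure_ne_zero (Subgroup.centralizer ({(Quotient.out c : G)} : Set G)) (isClosed_coe_centralizer_singleton (Quotient.out c))
    (t (Quotient.out c)) ν hm (hadm c hc).1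

/-- **… hence is a Haar measure** on a group carrying a two-sided Haar measure `νref` (★ `isHaarMeasure_of_isMulRightInvariant_of_ne_zero`).
[cite: Folland1999, Thm 11.9] [cite: Rogawski1990, §1.7 p. 6] -/
theorem _root_.Literature.NumberTheory.Automorphic.OrbitalMeasureFamily.IsQuotientOf.isHaarMeasure_of_isAdmissibleOn {P : G → Prop} {ν : Measure G}
    [IsFiniteMeasureOnCompacts ν] [ν.IsMulRightInvariant] {t : ∀ γ : G, Measure (Subgroup.centralizer ({γ} : Set G))} {m : OrbitalMeasureFamily G}
    (hW : m.IsQuotientOf P ν t) (hadm : m.IsAdmissibleOn P) (c : ConjClasses G) (hc : P (Quotient.out c))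
    (νref : Measure G) [νref.IsHaarMeasure] [νref.IsMulRightInvariant] : ν.IsHaarMeasure :=
  isHaarMeasure_of_isMulRightInvariant_of_ne_zero νref ν (hW.ne_zero_of_isAdmissibleOn hadm c hc)

end Generic

namespace Literature.NumberTheory.Rogawski1990

/-! ## §2 Regular elements of `U(H)(L⁺ ⊗ ℝ)` exist -/

section Regular

variable (L : Type) [Field L] [NumberField L] [IsCMField L]

/-- On a DIAGONAL carrier the torus point `t(θ)` with angles `θ_{w,i} = i` (`i = 0, 1, 2 < 2π`) is regular (★ `isRegularElt_archDiagTorus_exp_iff`).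
[cite: Rogawski1990, §3.1 p. 19; §8.4 p. 126] -/
theorem isRegularElt_archDiagTorus_exp_natCast (α : Fin 3 → L) :
    IsRegularElt (((archDiagTorus L 3 α (fun _ i => Circle.exp ((i : ℕ) : ℝ)) :
        arch (↥(maximalRealSubfield L)) L (IsCMField.complexConj L) 3 (Matrix.diagonal α)) : GL (Fin 3) (mixedSpace L))) := by
  rw [isRegularElt_archDiagTorus_exp_iff]
  rintro w i j hij ⟨m, hm⟩
  have hi : ((i : ℕ) : ℝ) ≤ 2 := by exact_mod_cast Nat.lt_succ_iff.mp i.isLt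
  have hj : ((j : ℕ) : ℝ) ≤ 2 := by exact_mod_cast Nat.lt_succ_iff.mp j.isLt
  have hi0 : (0 : ℝ) ≤ ((i : ℕ) : ℝ) := by positivity
  have hj0 : (0 : ℝ) ≤ ((j : ℕ) : ℝ) := by positivity
  have hπ : 3 < Real.pi := Real.pi_gt_three
  -- `|i - j| ≤ 2 < 2π` forces `m = 0`, then `i = j`
  rcases lt_trichotomy m 0 with hm0 | hm0 | hm0
  · have : (m : ℝ) ≤ -1 := by exact_mod_cast Int.le_sub_one_of_lt hm0
    nlinarith
  · subst hm0
    simp only [Int.cast_zero, zero_mul, add_zero, Nat.cast_inj] at hm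
    exact hij (Fin.ext hm)
  · have : (1 : ℝ) ≤ (m : ℝ) := by exact_mod_cast hm0
    nlinarith

/-- **`U(H)(L⁺ ⊗ ℝ)` HAS A REGULAR SEMISIMPLE ELEMENT** for every `c`-hermitian non-degenerate `H ∈ M₃(L)`: transport the regular torus point of
`isRegularElt_archDiagTorus_exp_natCast` from a rational diagonal frame `σ(P)ᵀ · diag α · P = H` (★ Landherr `exists_rational_diagonal_frame`) along the form
congruence `g ↦ (P⊗1)⁻¹ g (P⊗1)` (★ `unitaryGroupOfFormCongrOfEq`, ★ `formCongr_map_mixedEmbedding_archFormOf_eq`); regularity is conjugation invariant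
(★ `isRegularElt_of_isConj`). [cite: Rogawski1990, §3.1 p. 19; §14.2 (14.2.1) p. 232] -/
theorem exists_isRegularElt_arch (H : Matrix (Fin 3) (Fin 3) L) (hherm : (H.map (cmConjRingHom L))ᵀ = H) (hdet : H.det ≠ 0) :
    ∃ γ : arch (↥(maximalRealSubfield L)) L (IsCMField.complexConj L) 3 H, IsRegularElt ((γ : GL (Fin 3) (mixedSpace L))) := by
  obtain ⟨α, P, hP, -, -⟩ := exists_rational_diagonal_frame L H hherm hdet
  let Ψ : arch (↥(maximalRealSubfield L)) L (IsCMField.complexConj L) 3 H ≃ₜ* arch (↥(maximalRealSubfield L)) L (IsCMField.complexConj L) 3 (Matrix.diagonal α) :=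
    unitaryGroupOfFormCongrOfEq (conjMixed (↥(maximalRealSubfield L)) L (IsCMField.complexConj L)) (Matrix.GeneralLinearGroup.map (mixedEmbedding L) P)
      (archFormOf L 3 (Matrix.diagonal α)) (archFormOf L 3 H) (formCongr_map_mixedEmbedding_archFormOf_eq L hP)
  set t : arch (↥(maximalRealSubfield L)) L (IsCMField.complexConj L) 3 (Matrix.diagonal α) := archDiagTorus L 3 α (fun _ i => Circle.exp ((i : ℕ) : ℝ)) with ht
  refine ⟨Ψ.symm t, ?_⟩
  have hcoe : ((Ψ.symm t : arch (↥(maximalRealSubfield L)) L (IsCMField.complexConj L) 3 H) : GL (Fin 3) (mixedSpace L)) =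
      (Matrix.GeneralLinearGroup.map (mixedEmbedding L) P)⁻¹ * (t : GL (Fin 3) (mixedSpace L)) * Matrix.GeneralLinearGroup.map (mixedEmbedding L) P := rfl
  rw [hcoe]
  refine isRegularElt_of_isConj ?_ (isRegularElt_archDiagTorus_exp_natCast L α)
  exact isConj_iff.mpr ⟨(Matrix.GeneralLinearGroup.map (mixedEmbedding L) P)⁻¹, by rw [inv_inv]⟩

end Regular

/-! ## §3 `νGi`, `νqi` are Haar under `ArchCanonicalSingularMatrix` -/

section HaarOfMatrix

variable (L : Type) [Field L] [NumberField L] [IsCMField L] (H' : Matrix (Fin 3) (Fin 3) L) (T : ArchTransferFactor L H')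
    [MeasurableSpace (arch (↥(maximalRealSubfield L)) L (IsCMField.complexConj L) 3 H')] [BorelSpace (arch (↥(maximalRealSubfield L)) L (IsCMField.complexConj L) 3 H')]
    [∀ γ : arch (↥(maximalRealSubfield L)) L (IsCMField.complexConj L) 3 H',
      MeasurableSpace (arch (↥(maximalRealSubfield L)) L (IsCMField.complexConj L) 3 H' ⧸ Subgroup.centralizer ({γ} : Set (arch (↥(maximalRealSubfield L)) L (IsCMField.complexConj L) 3 H')))]
    [∀ γ : arch (↥(maximalRealSubfield L)) L (IsCMField.complexConj L) 3 H',
      BorelSpace (arch (↥(maximalRealSubfield L)) L (IsCMField.complexConj L) 3 H' ⧸ Subgroup.centralizer ({γ} : Set (arch (↥(maximalRealSubfield L)) L (IsCMField.complexConj L) 3 H')))]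
    [MeasurableSpace (arch (↥(maximalRealSubfield L)) L (IsCMField.complexConj L) 3 (Matrix.of fun i j : Fin 3 => if i.val + j.val + 1 = 3 then (1 : L) else 0))]
    [BorelSpace (arch (↥(maximalRealSubfield L)) L (IsCMField.complexConj L) 3 (Matrix.of fun i j : Fin 3 => if i.val + j.val + 1 = 3 then (1 : L) else 0))]
    [∀ γ : arch (↥(maximalRealSubfield L)) L (IsCMField.complexConj L) 3 (Matrix.of fun i j : Fin 3 => if i.val + j.val + 1 = 3 then (1 : L) else 0),
      MeasurableSpace (arch (↥(maximalRealSubfield L)) L (IsCMField.complexConj L) 3 (Matrix.of fun i j : Fin 3 => if i.val + j.val + 1 = 3 then (1 : L) else 0) ⧸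
        Subgroup.centralizer ({γ} : Set (arch (↥(maximalRealSubfield L)) L (IsCMField.complexConj L) 3 (Matrix.of fun i j : Fin 3 => if i.val + j.val + 1 = 3 then (1 : L) else 0))))]
    [∀ γ : arch (↥(maximalRealSubfield L)) L (IsCMField.complexConj L) 3 (Matrix.of fun i j : Fin 3 => if i.val + j.val + 1 = 3 then (1 : L) else 0),
      BorelSpace (arch (↥(maximalRealSubfield L)) L (IsCMField.complexConj L) 3 (Matrix.of fun i j : Fin 3 => if i.val + j.val + 1 = 3 then (1 : L) else 0) ⧸
        Subgroup.centralizer ({γ} : Set (arch (↥(maximalRealSubfield L)) L (IsCMField.complexConj L) 3 (Matrix.of fun i j : Fin 3 => if i.val + j.val + 1 = 3 then (1 : L) else 0))))]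
    [MeasurableSpace (arch (↥(maximalRealSubfield L)) L (IsCMField.complexConj L) 2 (Matrix.of fun i j : Fin 2 => if i.val + j.val + 1 = 2 then (1 : L) else 0) ×
          arch (↥(maximalRealSubfield L)) L (IsCMField.complexConj L) 1 (Matrix.of fun i j : Fin 1 => if i.val + j.val + 1 = 1 then (1 : L) else 0))]
    [BorelSpace (arch (↥(maximalRealSubfield L)) L (IsCMField.complexConj L) 2 (Matrix.of fun i j : Fin 2 => if i.val + j.val + 1 = 2 then (1 : L) else 0) ×
          arch (↥(maximalRealSubfield L)) L (IsCMField.complexConj L) 1 (Matrix.of fun i j : Fin 1 => if i.val + j.val + 1 = 1 then (1 : L) else 0))]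
    [∀ a : (arch (↥(maximalRealSubfield L)) L (IsCMField.complexConj L) 2 (Matrix.of fun i j : Fin 2 => if i.val + j.val + 1 = 2 then (1 : L) else 0) ×
          arch (↥(maximalRealSubfield L)) L (IsCMField.complexConj L) 1 (Matrix.of fun i j : Fin 1 => if i.val + j.val + 1 = 1 then (1 : L) else 0)),
      MeasurableSpace ((arch (↥(maximalRealSubfield L)) L (IsCMField.complexConj L) 2 (Matrix.of fun i j : Fin 2 => if i.val + j.val + 1 = 2 then (1 : L) else 0) ×
          arch (↥(maximalRealSubfield L)) L (IsCMField.complexConj L) 1 (Matrix.of fun i j : Fin 1 => if i.val + j.val + 1 = 1 then (1 : L) else 0)) ⧸ Subgroup.centralizer ({a} : Set (arch (↥(maximalRealSubfield L)) L (IsCMField.complexConj L) 2 (Matrix.of fun i j : Fin 2 => if i.val + j.val + 1 = 2 then (1 : L) else 0) ×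
          arch (↥(maximalRealSubfield L)) L (IsCMField.complexConj L) 1 (Matrix.of fun i j : Fin 1 => if i.val + j.val + 1 = 1 then (1 : L) else 0))))]
    [∀ a : (arch (↥(maximalRealSubfield L)) L (IsCMField.complexConj L) 2 (Matrix.of fun i j : Fin 2 => if i.val + j.val + 1 = 2 then (1 : L) else 0) ×
          arch (↥(maximalRealSubfield L)) L (IsCMField.complexConj L) 1 (Matrix.of fun i j : Fin 1 => if i.val + j.val + 1 = 1 then (1 : L) else 0)),
      BorelSpace ((arch (↥(maximalRealSubfield L)) L (IsCMField.complexConj L) 2 (Matrix.of fun i j : Fin 2 => if i.val + j.val + 1 = 2 then (1 : L) else 0) ×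
          arch (↥(maximalRealSubfield L)) L (IsCMField.complexConj L) 1 (Matrix.of fun i j : Fin 1 => if i.val + j.val + 1 = 1 then (1 : L) else 0)) ⧸ Subgroup.centralizer ({a} : Set (arch (↥(maximalRealSubfield L)) L (IsCMField.complexConj L) 2 (Matrix.of fun i j : Fin 2 => if i.val + j.val + 1 = 2 then (1 : L) else 0) ×
          arch (↥(maximalRealSubfield L)) L (IsCMField.complexConj L) 1 (Matrix.of fun i j : Fin 1 => if i.val + j.val + 1 = 1 then (1 : L) else 0))))]
    (νGi : Measure (arch (↥(maximalRealSubfield L)) L (IsCMField.complexConj L) 3 H'))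
    (νqi : Measure (arch (↥(maximalRealSubfield L)) L (IsCMField.complexConj L) 3 (Matrix.of fun i j : Fin 3 => if i.val + j.val + 1 = 3 then (1 : L) else 0)))
    (νHi : Measure (arch (↥(maximalRealSubfield L)) L (IsCMField.complexConj L) 2 (Matrix.of fun i j : Fin 2 => if i.val + j.val + 1 = 2 then (1 : L) else 0) ×
          arch (↥(maximalRealSubfield L)) L (IsCMField.complexConj L) 1 (Matrix.of fun i j : Fin 1 => if i.val + j.val + 1 = 1 then (1 : L) else 0)))
    [IsFiniteMeasureOnCompacts νGi] [νGi.IsMulRightInvariant] [IsFiniteMeasureOnCompacts νqi] [νqi.IsMulRightInvariant]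
    [IsFiniteMeasureOnCompacts νHi] [νHi.IsMulRightInvariant]
    (hanis : ∀ x : Fin 3 → L, hermForm (cmConjRingHom L) H' x x = 0 → x = 0)
    (m' : OrbitalMeasureFamily (arch (↥(maximalRealSubfield L)) L (IsCMField.complexConj L) 3 H'))
    (m : OrbitalMeasureFamily (arch (↥(maximalRealSubfield L)) L (IsCMField.complexConj L) 3 (Matrix.of fun i j : Fin 3 => if i.val + j.val + 1 = 3 then (1 : L) else 0)))
    (mHi : OrbitalMeasureFamily (arch (↥(maximalRealSubfield L)) L (IsCMField.complexConj L) 2 (Matrix.of fun i j : Fin 2 => if i.val + j.val + 1 = 2 then (1 : L) else 0) ×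
          arch (↥(maximalRealSubfield L)) L (IsCMField.complexConj L) 1 (Matrix.of fun i j : Fin 1 => if i.val + j.val + 1 = 1 then (1 : L) else 0)))
    (t' : ∀ γ' : arch (↥(maximalRealSubfield L)) L (IsCMField.complexConj L) 3 H', Measure (Subgroup.centralizer ({γ'} : Set (arch (↥(maximalRealSubfield L)) L (IsCMField.complexConj L) 3 H'))))
    (t : ∀ γ : arch (↥(maximalRealSubfield L)) L (IsCMField.complexConj L) 3 (Matrix.of fun i j : Fin 3 => if i.val + j.val + 1 = 3 then (1 : L) else 0),
      Measure (Subgroup.centralizer ({γ} : Set (arch (↥(maximalRealSubfield L)) L (IsCMField.complexConj L) 3 (Matrix.of fun i j : Fin 3 => if i.val + j.val + 1 = 3 then (1 : L) else 0)))))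
    (tH : ∀ γH : arch (↥(maximalRealSubfield L)) L (IsCMField.complexConj L) 2 (Matrix.of fun i j : Fin 2 => if i.val + j.val + 1 = 2 then (1 : L) else 0) ×
          arch (↥(maximalRealSubfield L)) L (IsCMField.complexConj L) 1 (Matrix.of fun i j : Fin 1 => if i.val + j.val + 1 = 1 then (1 : L) else 0),
      Measure (Subgroup.centralizer ({γH} : Set (arch (↥(maximalRealSubfield L)) L (IsCMField.complexConj L) 2 (Matrix.of fun i j : Fin 2 => if i.val + j.val + 1 = 2 then (1 : L) else 0) ×
          arch (↥(maximalRealSubfield L)) L (IsCMField.complexConj L) 1 (Matrix.of fun i j : Fin 1 => if i.val + j.val + 1 = 1 then (1 : L) else 0)))))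

/-- **`νGi` IS A HAAR MEASURE under `hACS`** (`H′` hermitian; `hACS`'s own `hanis` gives `det H′ ≠ 0`): (W′) + (i) at a regular class of `U(H′)(L⁺ ⊗ ℝ)` (§2) give
`νGi ≠ 0` (§1); right-invariant + finite on compacta + non-zero on the unimodular `U(H′)(L⁺ ⊗ ℝ)` (★ `modularCharacterFun_arch_eq_one`, reference `haar`) is Haar.
This discharges the `[ν′.IsHaarMeasure]` binder of ★ (W4e)∕(W4f) at `ν′ := νGi` inside the S1′ assembler. [cite: Rogawski1990, §14.2 (14.2.1) p. 232; §1.7 p. 6] [cite: Folland1999, Thm 11.9] -/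
theorem isHaarMeasure_of_archCanonicalSingularMatrix (hherm : (H'.map (cmConjRingHom L))ᵀ = H')
    (hACS : ArchCanonicalSingularMatrix L H' T νGi νqi νHi hanis m' m mHi t' t tH) : νGi.IsHaarMeasure := by
  have hd' : H'.det ≠ 0 := Godement.det_ne_zero_of_anisotropic L H' hanis
  obtain ⟨γ, hγ⟩ := exists_isRegularElt_arch L H' hherm hd'
  -- the class of `γ` has a regular representative
  have hc : IsRegularElt (((Quotient.out (ConjClasses.mk γ) : arch (↥(maximalRealSubfield L)) L (IsCMField.complexConj L) 3 H') : GL (Fin 3) (mixedSpace L))) := by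
    obtain ⟨q, hq⟩ := isConj_iff.mp (ConjClasses.mk_eq_mk_iff_isConj.mp (Quotient.out_eq (ConjClasses.mk γ)).symm)
    have hval : (((Quotient.out (ConjClasses.mk γ) : arch (↥(maximalRealSubfield L)) L (IsCMField.complexConj L) 3 H') : GL (Fin 3) (mixedSpace L))) =
        (q : GL (Fin 3) (mixedSpace L)) * (γ : GL (Fin 3) (mixedSpace L)) * (q : GL (Fin 3) (mixedSpace L))⁻¹ := by
      rw [← hq]; rfl
    rw [hval]
    exact (isRegularElt_conj_iff _ _).mpr hγ
  haveI : (haar : Measure (arch (↥(maximalRealSubfield L)) L (IsCMField.complexConj L) 3 H')).IsMulRightInvariant :=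
    isMulRightInvariant_of_modularCharacterFun_eq_one (modularCharacterFun_arch_eq_one L H' hherm hd') _
  exact hACS.2.2.2.2.2.2.1.isHaarMeasure_of_isAdmissibleOn hACS.1 (ConjClasses.mk γ) hc haar

/-- **`νqi` IS A HAAR MEASURE under `hACS`** (quasi-split side: `Φ₃` is hermitian ★ `antidiagOne_isHermitian` and invertible ★ `isUnit_antidiagOne_det`; (W) + (ii) at a
regular class of `U(Φ₃)(L⁺ ⊗ ℝ)`).  Discharges the `[ν.IsHaarMeasure]` binder of ★ (W4e)∕(W4f) at `ν := νqi`. [cite: Rogawski1990, §14.2 (14.2.1) p. 232; §1.7 p. 6] [cite: Folland1999, Thm 11.9] -/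
theorem isHaarMeasure_quasiSplit_of_archCanonicalSingularMatrix
    (hACS : ArchCanonicalSingularMatrix L H' T νGi νqi νHi hanis m' m mHi t' t tH) : νqi.IsHaarMeasure := by
  have hherm₃ := antidiagOne_isHermitian L 3
  have hd₃ : (Matrix.of fun i j : Fin 3 => if i.val + j.val + 1 = 3 then (1 : L) else 0).det ≠ 0 := (isUnit_antidiagOne_det L 3).ne_zero
  obtain ⟨γ, hγ⟩ := exists_isRegularElt_arch L _ hherm₃ hd₃
  have hc : IsRegularElt (((Quotient.out (ConjClasses.mk γ) : arch (↥(maximalRealSubfield L)) L (IsCMField.complexConj L) 3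
      (Matrix.of fun i j : Fin 3 => if i.val + j.val + 1 = 3 then (1 : L) else 0)) : GL (Fin 3) (mixedSpace L))) := by
    obtain ⟨q, hq⟩ := isConj_iff.mp (ConjClasses.mk_eq_mk_iff_isConj.mp (Quotient.out_eq (ConjClasses.mk γ)).symm)
    have hval : (((Quotient.out (ConjClasses.mk γ) : arch (↥(maximalRealSubfield L)) L (IsCMField.complexConj L) 3
        (Matrix.of fun i j : Fin 3 => if i.val + j.val + 1 = 3 then (1 : L) else 0)) : GL (Fin 3) (mixedSpace L))) =
        (q : GL (Fin 3) (mixedSpace L)) * (γ : GL (Fin 3) (mixedSpace L)) * (q : GL (Fin 3) (mixedSpace L))⁻¹ := by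
      rw [← hq]; rfl
    rw [hval]
    exact (isRegularElt_conj_iff _ _).mpr hγ
  haveI : (haar : Measure (arch (↥(maximalRealSubfield L)) L (IsCMField.complexConj L) 3 (Matrix.of fun i j : Fin 3 => if i.val + j.val + 1 = 3 then (1 : L) else 0))).IsMulRightInvariant :=
    isMulRightInvariant_of_modularCharacterFun_eq_one (modularCharacterFun_arch_eq_one L _ hherm₃ hd₃) _
  exact hACS.2.2.2.2.2.2.2.1.isHaarMeasure_of_isAdmissibleOn hACS.2.1 (ConjClasses.mk γ) hc haar

end HaarOfMatrix

end Literature.NumberTheory.Rogawski1990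

end
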